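import Mathlib
import Literature.Analysis.PDE.SingleEntropy.OleinikEntropyC1
import HarnessLib

/-!
# Distributional inequalities tested against Lipschitz functions

Topic `Literature/Analysis/PDE/SingleEntropy` — part of the formalization of
De Lellis–Otto–Westdickenberg, *Minimal entropy conditions for Burgers equation*, Quart. Appl.
Math. 62 (2004) 687–700, Thm 2.3 / Cor 2.5 (the named fact
`Literature.Analysis.PDE.deLellisOttoWestdickenberg_singleEntropy`).

`pairing_nonneg_of_lipschitz`: a distributional inequality `0 ≤ ∫_Ω (G₁ ∂ₜφ + G₂ ∂ₓφ)` for smooth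
nonnegative tests `φ` supported in the open set `Ω` (with `G₁, G₂ ∈ L^∞`) extends to nonnegative
Lipschitz tests with compact support in `Ω`, the derivatives being the a.e. line derivatives
(mollify the test function; `∂ᵥ(ρ̄ ⋆ ψ) = ρ̄ ⋆ ∂ᵥψ` by the integration by parts formula for
Lipschitz functions of Mathlib's Rademacher file). [folklore]
-/

noncomputable section

open MeasureTheory Set Filter Metric ContinuousLinearMap
open scoped Topology Convolution NNReal

namespace Literature.Analysis.PDE.SingleEntropy

variable (ρ : ContDiffBump (0 : ℝ × ℝ))

/-! ## Lipschitz test functions -/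

section LipschitzTests

open scoped NNReal

/-- The line derivative of the reflected bump. [folklore] -/
theorem lineDeriv_reflect_neg (p y v : ℝ × ℝ) :
    lineDeriv ℝ (fun z => ρ.normed volume (p - z)) y (-v)
      = fderiv ℝ (ρ.normed volume) (p - y) v := by
  rw [(differentiable_reflect ρ p y).lineDeriv_eq_fderiv, map_neg, fderiv_reflect_apply, neg_neg]

/-- A line derivative vanishes outside the topological support. [folklore] -/
theorem lineDeriv_eq_zero_of_notMem_tsupport {ψ : ℝ × ℝ → ℝ} {y : ℝ × ℝ}
    (hy : y ∉ tsupport ψ) (v : ℝ × ℝ) : lineDeriv ℝ ψ y v = 0 := by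
  have h0 : ψ =ᶠ[𝓝 y] 0 := notMem_tsupport_iff_eventuallyEq.mp hy
  have hd : HasFDerivAt ψ (0 : ℝ × ℝ →L[ℝ] ℝ) y :=
    (hasFDerivAt_const (0 : ℝ) y).congr_of_eventuallyEq (h0.trans (by rfl))
  rw [hd.differentiableAt.lineDeriv_eq_fderiv, hd.fderiv]
  rfl

/-- Derivative of the mollification of a Lipschitz function: `∂ᵥ(ρ̄ ⋆ ψ) = ρ̄ ⋆ ∂ᵥψ` with the
a.e. line derivative on the right (integration by parts for Lipschitz functions). [folklore] -/
theorem fderiv_mollify_lipschitz {ψ : ℝ × ℝ → ℝ} {L : ℝ≥0} (hψ : LipschitzWith L ψ)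
    (hψc : HasCompactSupport ψ) (p v : ℝ × ℝ) :
    fderiv ℝ (ρ.normed volume ⋆[lsmul ℝ ℝ, volume] ψ) p v
      = ∫ y, ρ.normed volume (p - y) * lineDeriv ℝ ψ y v := by
  obtain ⟨M, hM⟩ := hψc.exists_bound_of_continuous hψ.continuous
  have hM' : ∀ z, |ψ z| ≤ M := fun z => by simpa [Real.norm_eq_abs] using hM z
  rw [fderiv_mollify_apply ρ hψ.continuous.measurable hM' p v]
  obtain ⟨D, hD⟩ := ContDiff.lipschitzWith_of_hasCompactSupport (hasCompactSupport_reflect ρ p)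
    (contDiff_reflect ρ p) (by simp)
  have key := hψ.integral_lineDeriv_mul_eq (μ := volume) hD (hasCompactSupport_reflect ρ p) v
  simp_rw [lineDeriv_reflect_neg] at key
  calc ∫ y, fderiv ℝ (ρ.normed volume) (p - y) v * ψ y
      = ∫ y, lineDeriv ℝ ψ y v * ρ.normed volume (p - y) := key.symm
    _ = ∫ y, ρ.normed volume (p - y) * lineDeriv ℝ ψ y v := by
        congr 1; funext y; ring

/-- The mollification of a compactly supported function vanishes far from the support. [folklore] -/
theorem mollify_eq_zero_of_dist {g : ℝ × ℝ → ℝ} {K : Set (ℝ × ℝ)} (hK : ∀ y ∉ K, g y = 0)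
    {p : ℝ × ℝ} (hp : ∀ y ∈ K, ρ.rOut ≤ dist p y) :
    (ρ.normed volume ⋆[lsmul ℝ ℝ, volume] g) p = 0 := by
  rw [mollify_apply]
  have : ∀ y, ρ.normed volume (p - y) * g y = 0 := by
    intro y
    by_cases hy : y ∈ K
    · have : y ∉ ball p ρ.rOut := fun h => by
        rw [mem_ball, dist_comm] at h
        exact (lt_irrefl _) ((hp y hy).trans_lt h)
      simp [reflect_eq_zero ρ this]
    · simp [hK y hy]
  simp [this]

/-- **Entropy/divergence inequalities extend to Lipschitz test functions.** If
`0 ≤ ∫_Ω (G₁ ∂ₜφ + G₂ ∂ₓφ)` for all smooth nonnegative `φ` compactly supported in the open set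
`Ω`, with `G₁, G₂` bounded measurable, then the same holds for every nonnegative Lipschitz `ψ`
with compact support in `Ω`, the derivatives being the a.e. line derivatives. (Mollify `ψ`; the
derivatives of the mollifications are mollifications of the line derivatives, which converge
a.e.) [folklore] -/
theorem pairing_nonneg_of_lipschitz {Ω : Set (ℝ × ℝ)} (hΩ : IsOpen Ω) {G₁ G₂ : ℝ × ℝ → ℝ}
    (hG₁ : Measurable G₁) (hG₂ : Measurable G₂) {A : ℝ} (hA₁ : ∀ z, |G₁ z| ≤ A)
    (hA₂ : ∀ z, |G₂ z| ≤ A)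
    (hE : ∀ φ : ℝ × ℝ → ℝ, ContDiff ℝ (⊤ : ℕ∞) φ → HasCompactSupport φ → tsupport φ ⊆ Ω →
      (∀ p, 0 ≤ φ p) →
      0 ≤ ∫ p in Ω, (G₁ p * deriv (fun t => φ (t, p.2)) p.1
        + G₂ p * deriv (fun x => φ (p.1, x)) p.2))
    {ψ : ℝ × ℝ → ℝ} {L : ℝ≥0} (hψ : LipschitzWith L ψ) (hψc : HasCompactSupport ψ)
    (hψΩ : tsupport ψ ⊆ Ω) (hψ0 : ∀ p, 0 ≤ ψ p) :
    0 ≤ ∫ p, (G₁ p * lineDeriv ℝ ψ p (1, 0) + G₂ p * lineDeriv ℝ ψ p (0, 1)) := by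
  -- room around the support
  obtain ⟨δ, hδ, hthick⟩ := hψc.exists_cthickening_subset_open hΩ hψΩ
  set K' : Set (ℝ × ℝ) := cthickening δ (tsupport ψ) with hK'
  have hK'c : IsCompact K' := hψc.cthickening
  -- bumps
  let ρs : ℕ → ContDiffBump (0 : ℝ × ℝ) := fun n =>
    ⟨δ / (2 * ((n : ℝ) + 2)), δ / ((n : ℝ) + 2), by positivity, by
      rw [div_lt_div_iff_of_pos_left hδ (by positivity) (by positivity)]; linarith⟩
  have hrOut : ∀ n, (ρs n).rOut = δ / ((n : ℝ) + 2) := fun n => rfl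
  have hrIn : ∀ n, (ρs n).rIn = δ / (2 * ((n : ℝ) + 2)) := fun n => rfl
  have hr_lt : ∀ n, (ρs n).rOut < δ := fun n => by
    rw [hrOut, div_lt_iff₀ (by positivity)]; nlinarith
  have hr_tend : Tendsto (fun n => (ρs n).rOut) atTop (𝓝 0) := by
    have h1 : Tendsto (fun n : ℕ => δ / ((n : ℝ) + 2)) atTop (𝓝 0) := by
      have := (tendsto_const_div_atTop_nhds_zero_nat δ).comp (tendsto_add_atTop_nat 2)
      refine this.congr (fun n => ?_)
      simp [Function.comp]
    exact h1
  have hr2 : ∀ n, (ρs n).rOut ≤ 2 * (ρs n).rIn := fun n => by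
    rw [hrOut, hrIn]; apply le_of_eq; field_simp
  -- bounded measurable data
  obtain ⟨Mψ, hMψ⟩ := hψc.exists_bound_of_continuous hψ.continuous
  have hMψ' : ∀ z, |ψ z| ≤ Mψ := fun z => by simpa [Real.norm_eq_abs] using hMψ z
  have hDm : ∀ v, Measurable fun y => lineDeriv ℝ ψ y v := fun v =>
    measurable_lineDeriv hψ.continuous
  have hDb : ∀ v y, |lineDeriv ℝ ψ y v| ≤ L * ‖v‖ := fun v y => by
    simpa [Real.norm_eq_abs] using norm_lineDeriv_le_of_lipschitz ℝ hψ (x₀ := y) (v := v)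
  have hD0 : ∀ v, ∀ y ∉ tsupport ψ, lineDeriv ℝ ψ y v = 0 := fun v y hy =>
    lineDeriv_eq_zero_of_notMem_tsupport hy v
  -- the mollified test functions
  set Ψ : ℕ → ℝ × ℝ → ℝ := fun n => (ρs n).normed volume ⋆[lsmul ℝ ℝ, volume] ψ with hΨ
  have hΨs : ∀ n, ContDiff ℝ (⊤ : ℕ∞) (Ψ n) := fun n =>
    contDiff_mollify (ρs n) hψ.continuous.measurable hMψ'
  have hΨ0 : ∀ n p, 0 ≤ Ψ n p := fun n p => by
    simp only [hΨ]
    rw [mollify_apply]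
    exact integral_nonneg fun y => mul_nonneg ((ρs n).nonneg_normed _) (hψ0 y)
  have hΨc : ∀ n, HasCompactSupport (Ψ n) := fun n =>
    ((ρs n).hasCompactSupport_normed (μ := volume)).convolution (lsmul ℝ ℝ) hψc
  have hΨK : ∀ n, tsupport (Ψ n) ⊆ K' := by
    intro n
    apply closure_minimal _ hK'c.isClosed
    intro p hp
    by_contra hpK
    apply hp
    apply mollify_eq_zero_of_dist (ρs n) (K := tsupport ψ)
      (fun y hy => image_eq_zero_of_notMem_tsupport hy)
    intro y hy
    by_contra hlt
    push Not at hlt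
    exact hpK (mem_cthickening_of_dist_le p y δ _ hy ((hlt.le).trans (hr_lt n).le))
  have hΨΩ : ∀ n, tsupport (Ψ n) ⊆ Ω := fun n => (hΨK n).trans hthick
  -- derivative of the mollified test function = mollification of the line derivative
  have hΨd : ∀ n p v, fderiv ℝ (Ψ n) p v
      = ((ρs n).normed volume ⋆[lsmul ℝ ℝ, volume] fun y => lineDeriv ℝ ψ y v) p := by
    intro n p v
    simp only [hΨ]
    rw [fderiv_mollify_lipschitz (ρs n) hψ hψc, mollify_apply]
  -- the smooth inequality, rewritten
  have step : ∀ n, 0 ≤ ∫ p, (G₁ p * ((ρs n).normed volume ⋆[lsmul ℝ ℝ, volume]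
      fun y => lineDeriv ℝ ψ y (1, 0)) p
      + G₂ p * ((ρs n).normed volume ⋆[lsmul ℝ ℝ, volume] fun y => lineDeriv ℝ ψ y (0, 1)) p) := by
    intro n
    have h := hE (Ψ n) (hΨs n) (hΨc n) (hΨΩ n) (hΨ0 n)
    rw [setIntegral_pairing_eq_integral (hΨΩ n),
      integral_pairing_eq_fderiv ((hΨs n).differentiable (by simp))] at h
    simp_rw [hΨd] at h
    exact h
  -- pass to the limit
  have hconv : ∀ v, ∀ᵐ p ∂(volume : Measure (ℝ × ℝ)),
      Tendsto (fun n => ((ρs n).normed volume ⋆[lsmul ℝ ℝ, volume]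
        fun y => lineDeriv ℝ ψ y v) p) atTop (𝓝 (lineDeriv ℝ ψ p v)) := fun v =>
    ae_tendsto_mollify hr_tend hr2 (hDm v) (hDb v)
  have hvanish : ∀ n v, ∀ p ∉ K', ((ρs n).normed volume ⋆[lsmul ℝ ℝ, volume]
      fun y => lineDeriv ℝ ψ y v) p = 0 := by
    intro n v p hp
    apply mollify_eq_zero_of_dist (ρs n) (K := tsupport ψ) (hD0 v)
    intro y hy
    by_contra hlt
    push Not at hlt
    exact hp (mem_cthickening_of_dist_le p y δ _ hy ((hlt.le).trans (hr_lt n).le))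
  have lim : Tendsto (fun n => ∫ p, (G₁ p * ((ρs n).normed volume ⋆[lsmul ℝ ℝ, volume]
      fun y => lineDeriv ℝ ψ y (1, 0)) p
      + G₂ p * ((ρs n).normed volume ⋆[lsmul ℝ ℝ, volume] fun y => lineDeriv ℝ ψ y (0, 1)) p))
      atTop (𝓝 (∫ p, (G₁ p * lineDeriv ℝ ψ p (1, 0) + G₂ p * lineDeriv ℝ ψ p (0, 1)))) := by
    refine tendsto_integral_of_dominated_convergence
      (K'.indicator fun _ => A * (L * ‖((1 : ℝ), (0 : ℝ))‖) + A * (L * ‖((0 : ℝ), (1 : ℝ))‖))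
      ?_ ?_ ?_ ?_
    · intro n
      exact ((hG₁.mul (contDiff_mollify (ρs n) (hDm _) (hDb _)).continuous.measurable).add
        (hG₂.mul (contDiff_mollify (ρs n) (hDm _) (hDb _)).continuous.measurable))
        |>.aestronglyMeasurable
    · rw [integrable_indicator_iff hK'c.measurableSet]
      exact integrableOn_const (hK'c.measure_lt_top.ne)
    · intro n
      refine ae_of_all _ fun p => ?_
      by_cases hp : p ∈ K'
      · rw [indicator_of_mem hp]
        have h1 := abs_mollify_le (ρs n) (hDb (1, 0)) p
        have h2 := abs_mollify_le (ρs n) (hDb (0, 1)) p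
        rw [Real.norm_eq_abs]
        refine (abs_add_le _ _).trans (add_le_add ?_ ?_)
        · rw [abs_mul]; exact mul_le_mul (hA₁ p) h1 (abs_nonneg _) ((abs_nonneg _).trans (hA₁ p))
        · rw [abs_mul]; exact mul_le_mul (hA₂ p) h2 (abs_nonneg _) ((abs_nonneg _).trans (hA₂ p))
      · rw [indicator_of_notMem hp, hvanish n _ p hp, hvanish n _ p hp]
        simp
    · filter_upwards [hconv (1, 0), hconv (0, 1)] with p h1 h2
      exact ((tendsto_const_nhds.mul h1).add (tendsto_const_nhds.mul h2))
  exact ge_of_tendsto' lim step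

end LipschitzTests

end Literature.Analysis.PDE.SingleEntropy
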